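/-
Copyright (c) 2026 the pub-hodgecm-mathlib formalisation cell (harness21).  Prover seat hodgecm-mathlib-LH4-p09 (g8), req620 Track A «(D-RAM) FOUR-FRAME» squad
(heir dealer LH4-plan (g13) WORD #58 RULING C — (T-G-on) organs).  2026-09-04.
-/
import Summits.HodgeConjecture.HodgeConjecture.Theorems.F0P3cDyRamLabelledKappaGluedLocus          -- (this seat) K4: vacuous regime + tube genuine; brings ENGINE ★ p859717, ★ κG1 socket, ★ p859544 reads
import Summits.HodgeConjecture.HodgeConjecture.Theorems.F0P3cDyRamLabelledGluedLocusCensusFoot     -- ★ p859571 (this seat): `ball_of_witness`, `v_glueUnit_eq`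
import HarnessLib

/-!
# (D-RAM) four-frame, STAGE 1b — (S2b-κS) organ (T-G-on | G1), continued: the LABELLED κ-COUNT on `G1 (2ρ, 2ρ+2t′, 2ρ+2t′)` on the glue locus, GLUE-FOOT
# genuine regime (`n₁ = n₂ + 2t′`, `ρ ≤ n₂ < 2ρ`, `k < ℓ + 2ρ`): two balls on the glue invariant, nested iff a common fixed witness

Helper brick for dealer LH4-plan (g13) WORD #58 RULING C ((T-G-on) = this seat): `Theorems/` only, statement-first, ★-only imports, lane
`--supports stmt-HodgeConjecture-24833 --as helper`; it PAYS NO tier-0 row (count-neutral).  Needed for the EVEN-`d` two-token glued cells of F0P3a-p01 (g36)'s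
level trunk (odd `d` descends to one token — (D-lev) memo 7dc1372c); the token of record `D₂` is OFF the locus on the glue foot (LH4-p12's socket).

THE PICTURE (κ-twin of ★ p859571 §2).  On the glue foot the stable representatives are the stability ball `|g + g₀| ≤ |ϖ|^{e₀}` (`e₀ = 2ρ + 2t′ − n₂`, ★
`mapGL_latt_glued_rep_iff`), the token cuts the ball `|g + g_e| ≤ |ϖ|^E` (`E = ℓ + 2ρ + 2t′ − k`).  With a `σ`-fixed `f₀` in BOTH balls they are nested around `f₀`
(`ball_of_witness`), the finer one of exponent `max(e₀, E)` is a fixed sub-ball system (★ `level_of_mem_subBall`) and ★ `sum_kappaCount_glued_rep_subBall` evaluates it: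
`Σᶠ_{M ∈ G1, diag(e)M ⊆ ϖ^ℓM} κᵢ(M)·w(M) = [outer] · (ω(−1)ω(1+f₀)·[2d ≤ mx+1], ω(−1)ω(f₀)ω(1+f₀)·[2d+2t′ ≤ mx+1], ω(f₀)·[2d+2t′ ≤ mx+1])ᵢ · q^{2ρ+2t′−⌈mx∕2⌉}`,
`mx = max(e₀, E)`; with no fixed point in both balls the filter is empty and the sum is `0` (K4 `…_onLocus_of_no_witness` already covers «no witness in the token ball»;
here the finer statement «none in both»).

* **`finsum_kappaCount_mul_stabiliserWeight_stratum_G1_sep_onLocus_foot_of_witness`**, **`…_foot_of_no_common_witness`**.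

HONEST LABEL: helper organs for a HYPOTHESIS (two-token `hTrunk`); STAGE-1b tier-0 rows T₊∕T₋∕regular and the six ED. 5 stubs stay OPEN; HC_CM is proved only modulo
the 7 printed citations (2 remaining named inputs: hLiu418 = `stmt-HodgeConjecture-24832`, h413 = `stmt-HodgeConjecture-24833`) until rung 0 closes.

## References
* [Kottwitz1986BaseChangeUnits] R. E. Kottwitz, *Base change for unit elements of Hecke algebras*, Compositio Math. 60 (1986), §1 pp. 240–241 (κ-orbital integrals of units as signed lattice counts modulo the torus).
* [LanglandsShelstad1987] R. P. Langlands, D. Shelstad, *On the definition of transfer factors*, Math. Ann. 278 (1987), §3 (κ as a character).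
* [Rogawski1990] J. D. Rogawski, *Automorphic Representations of Unitary Groups in Three Variables*, Ann. of Math. Stud. 123 (1990), §4.9 Prop. 4.9.1 (a) p. 55.
* [Serre1979] J.-P. Serre, *Local Fields*, GTM 67 (1979), Ch. V §3 Prop. 5, Cor. 3 (norm residue symbol behind `ω`).
-/

set_option autoImplicit false

noncomputable section

namespace Summit.HodgeConjecture.HodgeConjecture.Cruxes.H413.F0P3cDyRamLabelledKappaGluedLocusFoot

open Matrix WithZero
open Literature.NumberTheory.Automorphic Literature.NumberTheory.Automorphic.HermitianLattice
open Literature.NumberTheory.Automorphic.UnitaryLatticeTree Literature.NumberTheory.Automorphic.UnitaryThreeFourFrame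
open Literature.NumberTheory.LocalFields.WildQuadraticDatum
open Summit.HodgeConjecture.HodgeConjecture.Cruxes.H413.F0P3cDyRamDiagonalTorusDefs
open Summit.HodgeConjecture.HodgeConjecture.Cruxes.H413.F0P3cDyRamDiagonalStrataDefs
open Summit.HodgeConjecture.HodgeConjecture.Cruxes.H413.F0P3cDyRamDiagonalKappaCountDefs
open Summit.HodgeConjecture.HodgeConjecture.Cruxes.H413.F0P3cDyRamDiagonalKappaGluedDecomposition (mapGL_latt_glued_rep_iff)
open Summit.HodgeConjecture.HodgeConjecture.Cruxes.H413.F0P3cDyRamDiagonalKappaGluedSocket (sum_kappaCount_glued_rep_subBall)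
open Summit.HodgeConjecture.HodgeConjecture.Cruxes.H413.F0P3cDyRamDiagonalKappaGluedClassSums (level_of_mem_subBall)
open Summit.HodgeConjecture.HodgeConjecture.Cruxes.H413.F0P3cDyRamDiagonalGluedStabiliserIndex (ne_zero_and_v_lt_one_of_v_eq_exp)
open Summit.HodgeConjecture.HodgeConjecture.Cruxes.H413.F0P3cDyRamDiagonalGluedStabiliserMembership (pow_mul_le_pow_add_iff)
open Summit.HodgeConjecture.HodgeConjecture.Cruxes.H413.F0P3cDyRamDiagonalGluedStratum (stratum_G1_eq)
open Summit.HodgeConjecture.HodgeConjecture.Cruxes.H413.F0P3cDyRamDiagonalGluedTorusOrbits (exists_gl_coe_eq_glued)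
open Summit.HodgeConjecture.HodgeConjecture.Cruxes.H413.F0P3cDyRamDiagonalGluedClassRepresentatives (exists_fixed_class_representatives)
open Summit.HodgeConjecture.HodgeConjecture.Cruxes.H413.F0P3cDyRamFourFrameCensusDefs
open Summit.HodgeConjecture.HodgeConjecture.Cruxes.H413.F0P3cDyRamDiagonalOrbitCountLabelled (latticeInLevel_mapGL_diagGLUnits_iff)
open Summit.HodgeConjecture.HodgeConjecture.Cruxes.H413.F0P3cDyRamLabelledGluedLocusCensus (latticeInLevel_diagonal_latt_glued_iff_onLocus v_glueRatio_eq)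
open Summit.HodgeConjecture.HodgeConjecture.Cruxes.H413.F0P3cDyRamLabelledGluedLocusCensusFoot (ball_of_witness v_glueUnit_eq)
open Summit.HodgeConjecture.HodgeConjecture.Cruxes.H413.F0P3cDyRamLabelledKappaGluedStratum (finsum_kappaCount_mul_stabiliserWeight_glued_sep_eq)
open scoped Valued WithZero Matrix MatrixGroups

variable {K : Type} [Field K] [Valued K ℤᵐ⁰] [CompleteSpace K] [Fintype 𝓀[K]] {σ : K →+* K} {ϖ : K} {d t : ℕ} {α β : K} {N₀ n₁ n₂ n₃ : ℕ}
  {T : GL (Fin 3) K}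

open Classical in
/-- **HEAD — LABELLED κ-WEIGHTED G1 SUM, GLUE FOOT, GENUINE REGIME, WITH A FIXED WITNESS IN BOTH BALLS** (`n₁ = n₂ + 2t′`, `ρ ≤ n₂ < 2ρ`, `e₀ = 2ρ + 2t′ − n₂`;
`v(e₂−e₀) = k < ℓ + 2ρ`, `v(e₂−e₁) = k + 2t′`, `E = ℓ + 2ρ + 2t′ − k`; `σ f₀ = f₀`, `|f₀ + g₀| ≤ |ϖ|^{e₀}`, `|f₀ + g_e| ≤ |ϖ|^E`; `mx = max(e₀, E)`):
`Σᶠ_{M ∈ G1, diag(e)M ⊆ ϖ^ℓM} κᵢ(M)·w(M) = [outer] · (ω(−1)ω(1+f₀)·[2d ≤ mx+1], ω(−1)ω(f₀)ω(1+f₀)·[2d+2t′ ≤ mx+1], ω(f₀)·[2d+2t′ ≤ mx+1])ᵢ · q^{2ρ+2t′−⌈mx∕2⌉}`.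
[cite: Kottwitz1986BaseChangeUnits, §1 pp. 240–241] [cite: LanglandsShelstad1987, §3] [cite: Serre1979, Ch. V §3 Prop. 5, Cor. 3] [cite: Rogawski1990, §4.9 Prop. 4.9.1 (a) p. 55] -/
theorem finsum_kappaCount_mul_stabiliserWeight_stratum_G1_sep_onLocus_foot_of_witness (hD : IsRamifiedQuadraticDatum σ ϖ d t) (h2 : Valued.v (2 : K) < 1)
    (hE : IsElementDatum σ ϖ N₀ α β n₁ n₂ n₃) (hT : (T : Matrix (Fin 3) (Fin 3) K) = Matrix.diagonal ![α, β, 1])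
    (ρ t' : ℕ) (hρ : 1 ≤ ρ) (ht' : 1 ≤ t') (hfoot : n₁ = n₂ + 2 * t') (hρm : ρ ≤ n₂) (hm : n₂ < 2 * ρ) (i : Fin 3) (ℓ k : ℕ) (e : Fin 3 → K)
    (hk : Valued.v (e 2 - e 0) = Valued.v ϖ ^ k) (hloc : Valued.v (e 2 - e 1) = Valued.v ϖ ^ (k + 2 * t')) (hgen : k < ℓ + 2 * ρ)
    {f₀ : K} (hσf₀ : σ f₀ = f₀) (hf₀ : Valued.v (f₀ + (β - 1) / (α - 1)) ≤ Valued.v ϖ ^ (2 * ρ + 2 * t' - n₂))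
    (hf₀' : Valued.v (f₀ + (e 2 - e 1) / (e 2 - e 0)) ≤ Valued.v ϖ ^ (ℓ + 2 * ρ + 2 * t' - k)) :
    ∑ᶠ M ∈ {M | M ∈ stratum σ ϖ T ![2 * ρ, 2 * ρ + 2 * t', 2 * ρ + 2 * t'] ∧ LatticeInLevel ϖ ℓ (Matrix.diagonal e) M},
        (kappaCount σ ϖ 0 i M : ℚ) * stabiliserWeight σ M =
      if (Valued.v (e 0) ≤ Valued.v ϖ ^ ℓ ∧ Valued.v (e 1) ≤ Valued.v ϖ ^ ℓ ∧ Valued.v (e 2) ≤ Valued.v ϖ ^ ℓ) ∧ ℓ + ρ ≤ k then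
        (![if 2 * d ≤ max (2 * ρ + 2 * t' - n₂) (ℓ + 2 * ρ + 2 * t' - k) + 1 then (normSign σ (-1 : K) : ℚ) * normSign σ (1 + f₀) else 0,
           if 2 * d + 2 * t' ≤ max (2 * ρ + 2 * t' - n₂) (ℓ + 2 * ρ + 2 * t' - k) + 1
             then (normSign σ (-1 : K) : ℚ) * normSign σ f₀ * normSign σ (1 + f₀) else 0,
           if 2 * d + 2 * t' ≤ max (2 * ρ + 2 * t' - n₂) (ℓ + 2 * ρ + 2 * t' - k) + 1 then (normSign σ f₀ : ℚ) else 0] : Fin 3 → ℚ) i *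
          (Fintype.card 𝓀[K] : ℚ) ^ (2 * ρ + 2 * t' - (max (2 * ρ + 2 * t' - n₂) (ℓ + 2 * ρ + 2 * t' - k) + 1) / 2)
      else 0 := by
  classical
  have hTr := trace_bound_of_isRamifiedQuadraticDatum hD h2
  obtain ⟨hσ, hvσ, hϖ, hfix, hd, -, -⟩ := id hD
  obtain ⟨hαn, hβn, -, -, -, h₁, h₂, h₃, -, -, -⟩ := id hE
  have hα := UnitaryThreeFourFrame.v_eq_one_of_mul_map_eq_one hvσ hαn
  have hβ := UnitaryThreeFourFrame.v_eq_one_of_mul_map_eq_one hvσ hβn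
  obtain ⟨hϖ0, hϖ1⟩ := ne_zero_and_v_lt_one_of_v_eq_exp hϖ
  have hvϖ : 0 < Valued.v ϖ := (Valuation.pos_iff _).2 hϖ0
  obtain ⟨hi1, hi2, -⟩ := isoceles_depths hϖ h₁ h₂ h₃
  have hn₃ : n₃ = n₂ := by
    rcases min_le_iff.1 hi1 with h | h <;> rcases min_le_iff.1 hi2 with h' | h' <;> omega
  subst hn₃
  rw [hfoot] at h₁
  have h₃' : Valued.v (β - α) = Valued.v ϖ ^ n₃ := by rw [Valuation.map_sub_swap, h₃]
  have hg₀ : Valued.v ((β - 1) / (α - 1)) = Valued.v ϖ ^ (2 * t') := v_glueUnit_eq hvϖ.ne' h₁ h₂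
  have hge : Valued.v ((e 2 - e 1) / (e 2 - e 0)) = Valued.v ϖ ^ (2 * t') := v_glueRatio_eq hϖ0 hk hloc
  -- the class representatives (as a Finset) and the reference frames
  obtain ⟨R₀, hR₀fin, -, hR1, hR2, hR3⟩ := exists_fixed_class_representatives hσ hvσ hfix hϖ hd ρ t' hρ
  set R : Finset K := hR₀fin.toFinset with hRdef
  have hmemR : ∀ g, g ∈ R ↔ g ∈ R₀ := fun g => Set.Finite.mem_toFinset hR₀fin
  have hR1' : ∀ g ∈ R, σ g = g ∧ Valued.v g = Valued.v ϖ ^ (2 * t') := fun g hg => hR1 g ((hmemR g).1 hg)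
  have hR2' : ∀ f : K, σ f = f → Valued.v f = Valued.v ϖ ^ (2 * t') → ∃ g ∈ R, Valued.v (f - g) ≤ Valued.v ϖ ^ (ρ + 2 * t') :=
    fun f hσf hvf => by obtain ⟨g, hg, h⟩ := hR2 f hσf hvf; exact ⟨g, (hmemR g).2 hg, h⟩
  have hR3' : ∀ g ∈ R, ∀ g' ∈ R, Valued.v (g - g') ≤ Valued.v ϖ ^ (ρ + 2 * t') → g = g' :=
    fun g hg g' hg' h => hR3 g ((hmemR g).1 hg) g' ((hmemR g').1 hg') h
  choose V₀ hV₀ using fun g : K => exists_gl_coe_eq_glued (1 : K) 1 g (pow_ne_zero ρ hϖ0) (pow_ne_zero (2 * ρ + 2 * t') hϖ0)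
  have hreadV : ∀ g : K, LatticeInLevel ϖ ℓ (Matrix.diagonal e) (latt (V₀ g : Matrix (Fin 3) (Fin 3) K)) ↔
      ((Valued.v (e 0) ≤ Valued.v ϖ ^ ℓ ∧ Valued.v (e 1) ≤ Valued.v ϖ ^ ℓ ∧ Valued.v (e 2) ≤ Valued.v ϖ ^ ℓ) ∧ ℓ + ρ ≤ k) ∧
        Valued.v ϖ ^ k * Valued.v (g + (e 2 - e 1) / (e 2 - e 0)) ≤ Valued.v ϖ ^ (ℓ + 2 * ρ + 2 * t') := fun g => by
    have h := latticeInLevel_diagonal_latt_glued_iff_onLocus hϖ ℓ ρ t' k ht' e hk hloc (x := 1) (ζ := 1) (map_one _) (map_one _) g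
    rw [show g / ((1 : K) * 1) = g by rw [mul_one, div_one]] at h
    rw [hV₀ g]
    exact h
  have hstabV : ∀ g : K, mapGL T (latt (V₀ g : Matrix (Fin 3) (Fin 3) K)) = latt (V₀ g : Matrix (Fin 3) (Fin 3) K) ↔
      Valued.v (g + (β - 1) / (α - 1)) ≤ Valued.v ϖ ^ (2 * ρ + 2 * t' - n₃) := fun g =>
    mapGL_latt_glued_rep_iff hϖ hα hβ T hT h₁ h₂ h₃' hρm (by omega) g (V₀ g) (hV₀ g)
  rw [stratum_G1_eq hvσ hfix hϖ T hρ (by omega : 1 ≤ 2 * t'),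
    finsum_kappaCount_mul_stabiliserWeight_glued_sep_eq hσ hvσ hfix hϖ hd hTr T hT ρ t' hρ ht' R hR1' hR2' hR3' V₀ hV₀ i
      (fun M => LatticeInLevel ϖ ℓ (Matrix.diagonal e) M) (fun u _ M => latticeInLevel_mapGL_diagGLUnits_iff u ϖ ℓ e M),
    ← Nat.card_eq_fintype_card]
  by_cases hout : (Valued.v (e 0) ≤ Valued.v ϖ ^ ℓ ∧ Valued.v (e 1) ≤ Valued.v ϖ ^ ℓ ∧ Valued.v (e 2) ≤ Valued.v ϖ ^ ℓ) ∧ ℓ + ρ ≤ k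
  · rw [if_pos hout]
    have hEeq : ℓ + 2 * ρ + 2 * t' = k + (ℓ + 2 * ρ + 2 * t' - k) := by omega
    -- the finer ball around `f₀`: exponent `mx = max(e₀, E)`; both balls follow from it by `ball_of_witness`
    set mx : ℕ := max (2 * ρ + 2 * t' - n₃) (ℓ + 2 * ρ + 2 * t' - k) with hmx
    have hmx₀ : 2 * ρ + 2 * t' - n₃ ≤ mx := le_max_left _ _
    have hmxE : ℓ + 2 * ρ + 2 * t' - k ≤ mx := le_max_right _ _
    have hf₀mx : Valued.v (f₀ - f₀) ≤ Valued.v ϖ ^ mx := by rw [sub_self, map_zero]; exact zero_le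
    -- membership in the finer ball around `f₀` ⟺ both ball conditions
    have hiff : ∀ g : K, (Valued.v (g + (β - 1) / (α - 1)) ≤ Valued.v ϖ ^ (2 * ρ + 2 * t' - n₃) ∧
        Valued.v (g + (e 2 - e 1) / (e 2 - e 0)) ≤ Valued.v ϖ ^ (ℓ + 2 * ρ + 2 * t' - k)) ↔ Valued.v (g - f₀) ≤ Valued.v ϖ ^ mx := by
      intro g
      constructor
      · rintro ⟨hb₀, hbe⟩
        rcases le_total (2 * ρ + 2 * t' - n₃) (ℓ + 2 * ρ + 2 * t' - k) with hle | hle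
        · rw [hmx, max_eq_right hle, show g - f₀ = (g + (e 2 - e 1) / (e 2 - e 0)) - (f₀ + (e 2 - e 1) / (e 2 - e 0)) by ring]
          exact Valuation.map_sub_le _ hbe hf₀'
        · rw [hmx, max_eq_left hle, show g - f₀ = (g + (β - 1) / (α - 1)) - (f₀ + (β - 1) / (α - 1)) by ring]
          exact Valuation.map_sub_le _ hb₀ hf₀
      · intro h
        refine ⟨?_, ?_⟩
        · rw [show g + (β - 1) / (α - 1) = (g - f₀) + (f₀ + (β - 1) / (α - 1)) by ring]
          exact Valuation.map_add_le _ (h.trans (pow_le_pow_right_of_le_one' hϖ1.le hmx₀)) hf₀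
        · rw [show g + (e 2 - e 1) / (e 2 - e 0) = (g - f₀) + (f₀ + (e 2 - e 1) / (e 2 - e 0)) by ring]
          exact Valuation.map_add_le _ (h.trans (pow_le_pow_right_of_le_one' hϖ1.le hmxE)) hf₀'
    have hfilter : R.filter (fun g => mapGL T (latt (V₀ g : Matrix (Fin 3) (Fin 3) K)) = latt (V₀ g : Matrix (Fin 3) (Fin 3) K) ∧
          LatticeInLevel ϖ ℓ (Matrix.diagonal e) (latt (V₀ g : Matrix (Fin 3) (Fin 3) K))) =
        R.filter (fun g => Valued.v (g - f₀) ≤ Valued.v ϖ ^ mx) := by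
      refine Finset.filter_congr fun g _ => ?_
      rw [hstabV g, hreadV g, hEeq, pow_mul_le_pow_add_iff hϖ0, ← hiff g]
      exact ⟨fun h => ⟨h.1, h.2.2⟩, fun h => ⟨h.1, hout, h.2⟩⟩
    -- `|f₀| = |ϖ|^{2t′}`
    have hlt : Valued.v ϖ ^ (ℓ + 2 * ρ + 2 * t' - k) < Valued.v ϖ ^ (2 * t') := pow_lt_pow_right_of_lt_one₀ hvϖ hϖ1 (by omega)
    have hvf₀ : Valued.v f₀ = Valued.v ϖ ^ (2 * t') := by
      have h := Valuation.map_sub_eq_of_lt_left Valued.v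
        (hge ▸ (by rw [show (e 2 - e 1) / (e 2 - e 0) - (-f₀) = f₀ + (e 2 - e 1) / (e 2 - e 0) by ring]; exact hf₀'.trans_lt hlt) :
          Valued.v ((e 2 - e 1) / (e 2 - e 0) - (-f₀)) < Valued.v ((e 2 - e 1) / (e 2 - e 0)))
      rw [show (e 2 - e 1) / (e 2 - e 0) - ((e 2 - e 1) / (e 2 - e 0) - -f₀) = -f₀ by ring, Valuation.map_neg] at h
      rw [h, hge]
    -- the sub-ball system of exponent `mx` (`2t′ < mx ≤ ρ + 2t′`)
    have hmx1 : 2 * t' < mx := lt_of_lt_of_le (by omega) hmxE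
    have hmx2 : mx ≤ ρ + 2 * t' := max_le (by omega) (by omega)
    set S : Finset K := R.filter (fun g => Valued.v (g - f₀) ≤ Valued.v ϖ ^ mx) with hS
    have hS1 : ∀ g ∈ S, g ∈ {g : K | σ g = g ∧ Valued.v (g - f₀) ≤ Valued.v ϖ ^ mx} := fun g hg => by
      obtain ⟨hgR, hge'⟩ := Finset.mem_filter.1 hg
      exact ⟨(hR1' g hgR).1, hge'⟩
    have hS2 : ∀ f ∈ {g : K | σ g = g ∧ Valued.v (g - f₀) ≤ Valued.v ϖ ^ mx}, ∃ g ∈ S, Valued.v (f - g) ≤ Valued.v ϖ ^ (ρ + 2 * t') := by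
      intro f hf
      obtain ⟨hσf, hvf⟩ := level_of_mem_subBall hD hmx1 hvf₀ hf
      obtain ⟨g, hg, hfg⟩ := hR2' f hσf hvf
      refine ⟨g, Finset.mem_filter.2 ⟨hg, ?_⟩, hfg⟩
      rw [show g - f₀ = (f - f₀) - (f - g) by ring]
      exact Valuation.map_sub_le _ hf.2 (hfg.trans (pow_le_pow_right_of_le_one' hϖ1.le hmx2))
    have hS3 : ∀ g ∈ S, ∀ g' ∈ S, Valued.v (g - g') ≤ Valued.v ϖ ^ (ρ + 2 * t') → g = g' :=
      fun g hg g' hg' h => hR3' g (Finset.mem_filter.1 hg).1 g' (Finset.mem_filter.1 hg').1 h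
    rw [hfilter, sum_kappaCount_glued_rep_subBall hD h2 hρ ht' hmx1 hmx2 hσf₀ hvf₀ S hS1 hS2 hS3 V₀ hV₀ i,
      ← mul_comm ((Nat.card 𝓀[K] : ℚ) ^ _), ← mul_assoc, ← pow_add,
      show 2 * ρ + 2 * t' - (ρ + 2 * t' + 1) / 2 + ((ρ + 2 * t' + 1) / 2 - (mx + 1) / 2) = 2 * ρ + 2 * t' - (mx + 1) / 2 by omega, mul_comm]
  · rw [if_neg hout]
    have hnone : ∀ g ∈ R, ¬ (mapGL T (latt (V₀ g : Matrix (Fin 3) (Fin 3) K)) = latt (V₀ g : Matrix (Fin 3) (Fin 3) K) ∧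
        LatticeInLevel ϖ ℓ (Matrix.diagonal e) (latt (V₀ g : Matrix (Fin 3) (Fin 3) K))) := fun g _ h => hout ((hreadV g).1 h.2).1
    rw [Finset.filter_false_of_mem hnone, Finset.sum_empty, mul_zero]

omit [CompleteSpace K] in
/-- **HEAD — LABELLED κ-WEIGHTED G1 SUM, GLUE FOOT, GENUINE REGIME, NO FIXED POINT IN BOTH BALLS**: if no `σ`-fixed `f` satisfies both `|f + g₀| ≤ |ϖ|^{2ρ+2t′−n₂}`
and `|f + g_e| ≤ |ϖ|^{ℓ+2ρ+2t′−k}` (`k < ℓ + 2ρ`), no stable representative carries the token and the label-cut κ-sum is `0`.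
[cite: Kottwitz1986BaseChangeUnits, §1 pp. 240–241] [cite: LanglandsShelstad1987, §3] -/
theorem finsum_kappaCount_mul_stabiliserWeight_stratum_G1_sep_onLocus_foot_of_no_common_witness (hD : IsRamifiedQuadraticDatum σ ϖ d t)
    (h2 : Valued.v (2 : K) < 1) (hE : IsElementDatum σ ϖ N₀ α β n₁ n₂ n₃) (hT : (T : Matrix (Fin 3) (Fin 3) K) = Matrix.diagonal ![α, β, 1])
    (ρ t' : ℕ) (hρ : 1 ≤ ρ) (ht' : 1 ≤ t') (hfoot : n₁ = n₂ + 2 * t') (hρm : ρ ≤ n₂) (hm : n₂ < 2 * ρ) (i : Fin 3) (ℓ k : ℕ) (e : Fin 3 → K)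
    (hk : Valued.v (e 2 - e 0) = Valued.v ϖ ^ k) (hloc : Valued.v (e 2 - e 1) = Valued.v ϖ ^ (k + 2 * t')) (hgen : k < ℓ + 2 * ρ)
    (hno : ¬ ∃ f : K, σ f = f ∧ Valued.v (f + (β - 1) / (α - 1)) ≤ Valued.v ϖ ^ (2 * ρ + 2 * t' - n₂) ∧
      Valued.v (f + (e 2 - e 1) / (e 2 - e 0)) ≤ Valued.v ϖ ^ (ℓ + 2 * ρ + 2 * t' - k)) :
    ∑ᶠ M ∈ {M | M ∈ stratum σ ϖ T ![2 * ρ, 2 * ρ + 2 * t', 2 * ρ + 2 * t'] ∧ LatticeInLevel ϖ ℓ (Matrix.diagonal e) M},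
        (kappaCount σ ϖ 0 i M : ℚ) * stabiliserWeight σ M = 0 := by
  classical
  have hTr := trace_bound_of_isRamifiedQuadraticDatum hD h2
  obtain ⟨hσ, hvσ, hϖ, hfix, hd, -, -⟩ := id hD
  obtain ⟨hαn, hβn, -, -, -, h₁, h₂, h₃, -, -, -⟩ := id hE
  have hα := UnitaryThreeFourFrame.v_eq_one_of_mul_map_eq_one hvσ hαn
  have hβ := UnitaryThreeFourFrame.v_eq_one_of_mul_map_eq_one hvσ hβn
  obtain ⟨hϖ0, hϖ1⟩ := ne_zero_and_v_lt_one_of_v_eq_exp hϖ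
  obtain ⟨hi1, hi2, -⟩ := isoceles_depths hϖ h₁ h₂ h₃
  have hn₃ : n₃ = n₂ := by
    rcases min_le_iff.1 hi1 with h | h <;> rcases min_le_iff.1 hi2 with h' | h' <;> omega
  subst hn₃
  rw [hfoot] at h₁
  have h₃' : Valued.v (β - α) = Valued.v ϖ ^ n₃ := by rw [Valuation.map_sub_swap, h₃]
  obtain ⟨R₀, hR₀fin, -, hR1, hR2, hR3⟩ := exists_fixed_class_representatives hσ hvσ hfix hϖ hd ρ t' hρ
  set R : Finset K := hR₀fin.toFinset with hRdef
  have hmemR : ∀ g, g ∈ R ↔ g ∈ R₀ := fun g => Set.Finite.mem_toFinset hR₀fin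
  have hR1' : ∀ g ∈ R, σ g = g ∧ Valued.v g = Valued.v ϖ ^ (2 * t') := fun g hg => hR1 g ((hmemR g).1 hg)
  have hR2' : ∀ f : K, σ f = f → Valued.v f = Valued.v ϖ ^ (2 * t') → ∃ g ∈ R, Valued.v (f - g) ≤ Valued.v ϖ ^ (ρ + 2 * t') :=
    fun f hσf hvf => by obtain ⟨g, hg, h⟩ := hR2 f hσf hvf; exact ⟨g, (hmemR g).2 hg, h⟩
  have hR3' : ∀ g ∈ R, ∀ g' ∈ R, Valued.v (g - g') ≤ Valued.v ϖ ^ (ρ + 2 * t') → g = g' :=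
    fun g hg g' hg' h => hR3 g ((hmemR g).1 hg) g' ((hmemR g').1 hg') h
  choose V₀ hV₀ using fun g : K => exists_gl_coe_eq_glued (1 : K) 1 g (pow_ne_zero ρ hϖ0) (pow_ne_zero (2 * ρ + 2 * t') hϖ0)
  have hreadV : ∀ g : K, LatticeInLevel ϖ ℓ (Matrix.diagonal e) (latt (V₀ g : Matrix (Fin 3) (Fin 3) K)) ↔
      ((Valued.v (e 0) ≤ Valued.v ϖ ^ ℓ ∧ Valued.v (e 1) ≤ Valued.v ϖ ^ ℓ ∧ Valued.v (e 2) ≤ Valued.v ϖ ^ ℓ) ∧ ℓ + ρ ≤ k) ∧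
        Valued.v ϖ ^ k * Valued.v (g + (e 2 - e 1) / (e 2 - e 0)) ≤ Valued.v ϖ ^ (ℓ + 2 * ρ + 2 * t') := fun g => by
    have h := latticeInLevel_diagonal_latt_glued_iff_onLocus hϖ ℓ ρ t' k ht' e hk hloc (x := 1) (ζ := 1) (map_one _) (map_one _) g
    rw [show g / ((1 : K) * 1) = g by rw [mul_one, div_one]] at h
    rw [hV₀ g]
    exact h
  have hstabV : ∀ g : K, mapGL T (latt (V₀ g : Matrix (Fin 3) (Fin 3) K)) = latt (V₀ g : Matrix (Fin 3) (Fin 3) K) ↔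
      Valued.v (g + (β - 1) / (α - 1)) ≤ Valued.v ϖ ^ (2 * ρ + 2 * t' - n₃) := fun g =>
    mapGL_latt_glued_rep_iff hϖ hα hβ T hT h₁ h₂ h₃' hρm (by omega) g (V₀ g) (hV₀ g)
  have hEeq : ℓ + 2 * ρ + 2 * t' = k + (ℓ + 2 * ρ + 2 * t' - k) := by omega
  rw [stratum_G1_eq hvσ hfix hϖ T hρ (by omega : 1 ≤ 2 * t'),
    finsum_kappaCount_mul_stabiliserWeight_glued_sep_eq hσ hvσ hfix hϖ hd hTr T hT ρ t' hρ ht' R hR1' hR2' hR3' V₀ hV₀ i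
      (fun M => LatticeInLevel ϖ ℓ (Matrix.diagonal e) M) (fun u _ M => latticeInLevel_mapGL_diagGLUnits_iff u ϖ ℓ e M)]
  have hnone : ∀ g ∈ R, ¬ (mapGL T (latt (V₀ g : Matrix (Fin 3) (Fin 3) K)) = latt (V₀ g : Matrix (Fin 3) (Fin 3) K) ∧
      LatticeInLevel ϖ ℓ (Matrix.diagonal e) (latt (V₀ g : Matrix (Fin 3) (Fin 3) K))) := fun g hg h =>
    hno ⟨g, (hR1' g hg).1, (hstabV g).1 h.1, by
      have h2' := ((hreadV g).1 h.2).2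
      rwa [hEeq, pow_mul_le_pow_add_iff hϖ0] at h2'⟩
  rw [Finset.filter_false_of_mem hnone, Finset.sum_empty, mul_zero]

end Summit.HodgeConjecture.HodgeConjecture.Cruxes.H413.F0P3cDyRamLabelledKappaGluedLocusFoot

end
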